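import Mathlib

/-!
# Seed checker C5–C8, v33 — ZERO-SYMBOL LAWS at the two-term door (letters seeing letters, multi-scale towers)

Cell `pub-hsemireg`, seat `hsemireg-c5c8-1`, generation 33.  Companion memo:
`Cruxes/BlochSeedDiscOne/SEED-CHECKER-C5C8-c5c8-1-g33.md`; scripts `g33/code/zerosymbol.py` (SCREEN 4: the
pattern-free zero-symbol census of a presentation json, reusing the g30 cohomology oracle `g30/code/seedcheck_json.py`)
and `g33/code/towertable.py` (the exact index table of the one-letter torus towers of hsemireg-semihom-2 g15/g16);
data `g33/out/*.json`.

HONEST FRAMING.  Nothing in this file is proved toward `HC`, `HC_CM`, `HC_AV`, ladder rung №4, `stmt-26512`,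
`stmt-18881` (`BlochSeedDiscOne`) or `H2`.  The seat produces evidence and typed files, not rungs; the registered stub
`stub_rung_pad4_seedAt` is neither restated nor weakened.  This module is a Mathlib-only record (the crux satellites are
unbuilt on the farm snapshot, g28 probe) of the ALGEBRAIC CORES of the g33 laws; the dictionary to sheaves — the
column spectral sequence `E₁^{c,q} = H^q(End^c R) ⇒ Ext^{c+q}(𝓔,𝓔)` of a two-term locally free resolution
`R = [𝓟 → 𝓝]` by line-bundle cells on `X = E_i^8`, the two symbol laws (N1) `σ_I(F¹Ext²) = 0` and (CAP) `σ_I|F⁰ = M_I ∘ Sym`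
of v32, Mumford's index theorem and the degenerate-line-bundle rule — is the pen proof of the memo (§1) and the exact
python census, exactly as in v30–v32.

* §1 (ZS) `zeroSymbol_not_injective`, `zeroSymbol_count`: if the semiregularity map restricted to `F⁰` factors as
  `σ ∘ q = M ∘ Sym` (`q` = passage from `d₁`-closed classes of `E₁^{0,2}` to `E_∞^{0,2} = F⁰/F¹`), then ONE closed class
  with zero symbol that is not hit (`q y ≠ 0`) makes `σ` non-injective; counting version: a subspace `Z₀` of closed
  zero-symbol classes with `finrank Z₀ > finrank (ker q)` suffices.
* §2 (MULT-1) `sum_le_sum_sq`, `multOne_of_cap_zero`, `mult_le_of_cap`: for a cell realised by `m = Σ_k c_k` copies in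
  twist classes of sizes `c_k`, `S = Σ c_k² ≥ m`; the block `⊕_k Mat_{c_k}(H^{0,2})` carries `28(S−1)` zero-symbol
  classes, so `28(S−1) ≤ cap` forces `m ≤ 1 + cap/28`, and `cap = 0` (all live partners non-degenerate: Mumford) forces
  multiplicity ONE.  `apexMult_pos`, `apexMult_four`: the tower apex `⟨H·1⟩^m` has `cap = 6·m·p_H` (`p_H` = P-letter
  mass AT the apex scale, `6 = h²_max` of the rank-4 kernel torus, oracle `D(x₀) = 1`), so `m ≥ 2 ⇒ p_H ≥ 1` and
  `m = 4, S ≥ 4 ⇒ p_H ≥ 4`.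
* §3 (DIR) `card_le_of_mem_span`, `not_linearIndependent_on_polynomialCurve`: `d+2` points on a polynomial curve of
  degree `≤ d` in a vector space are linearly dependent (cells `h·1 − y` of ONE phase: their minors vectors
  `(C_q(h·1 − y))_{q ≤ d}` are polynomial of degree `≤ d` in the scale `h`); `towerRigid_le`: with `#Φ` phases at most
  `3·#Φ + 1` rigid cells (the `h³` coefficient is phase-free); `blockSymbol_not_injective`: a linear
  relation `Σ λ_Z v_Z = 0` among the symbol directions of RIGID cells gives a non-zero kernel vector `(λ_Z τ)_Z` of the
  block symbol map `τ⃗ ↦ Σ_Z v_Z ∪ τ_Z` for every `τ ≠ 0` in `H^{0,2}`; `fourthDifference_cubic`: the exact relation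
  `(1,−4,6,−4,1)` found by `zerosymbol.py` on the synthetic test vector C (five scales `20..24` of one phase).
* §4 census arithmetic: the window budgets `5572 / 7504 / 8008` as sums of `h^{q,q+2} = C(8,q)·C(8,q+2)`, the rigid
  caps `199 / 268 / 286 / 112`, and the regression digits of the two toy presentations of record and of the synthetic
  test vectors (bottom apex `L_{−4I}^8` of toyPresB: `28·7 > 0 = cap`, DEAD; top apexes defer: `1092 ≤ 7680`,
  `896 ≤ 6336`).

Hygiene: `import Mathlib` only; every proof closed; no new type-class instances, no notation/macro, no axioms, no
`sorry`, no unsafe options (the only `set_option` silences the duplicated-namespace linter of the summit path).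
-/

set_option linter.dupNamespace false

namespace Summit.HodgeConjecture.HodgeConjecture.Cruxes.BlochSeedDiscOne.SeedChecker.ZeroSymbol

open Module

/-! ## §1  The zero-symbol law (ZS) -/

section ZS

variable {K : Type*} [Field K]
variable {Z Q S W : Type*} [AddCommGroup Z] [Module K Z] [AddCommGroup Q] [Module K Q]
  [AddCommGroup S] [Module K S] [AddCommGroup W] [Module K W]

/-- (ZS).  `Z` = the `d₁`-closed classes of `E₁^{0,2}`, `q : Z → Q = E_∞^{0,2}` (kernel = the hit classes),
`Sym : Z → S` the cell symbol, and the semiregularity map on `F⁰/F¹` factors as `σ ∘ q = M ∘ Sym` (law (CAP) of v32).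
A closed, un-hit class with zero symbol is a non-zero element of `ker σ`. -/
theorem zeroSymbol_not_injective (q : Z →ₗ[K] Q) (Sym : Z →ₗ[K] S) (M : S →ₗ[K] W) (σ : Q →ₗ[K] W)
    (hfac : σ ∘ₗ q = M ∘ₗ Sym) {y : Z} (hy0 : Sym y = 0) (hyq : q y ≠ 0) :
    ¬ Function.Injective σ := by
  intro hinj
  apply hyq
  apply hinj
  have h := LinearMap.congr_fun hfac y
  simp only [LinearMap.coe_comp, Function.comp_apply] at h
  rw [map_zero, h, hy0, map_zero]

/-- (ZS), counting form.  If a subspace `Z₀` of closed zero-symbol classes has dimension exceeding that of the hit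
classes `ker q`, some class of `Z₀` is un-hit and `σ` is not injective.  (Used with
`finrank Z₀ ≥ 28(S_Z − 1) − defect` and `finrank (ker q ∩ block) ≤ hit`: `28(S_Z − 1) > cap_Z` kills.) -/
theorem zeroSymbol_count [FiniteDimensional K Z] (q : Z →ₗ[K] Q) (Sym : Z →ₗ[K] S) (M : S →ₗ[K] W)
    (σ : Q →ₗ[K] W) (hfac : σ ∘ₗ q = M ∘ₗ Sym) (Z₀ : Submodule K Z) (hZ₀ : ∀ y ∈ Z₀, Sym y = 0)
    (hlt : finrank K (LinearMap.ker q) < finrank K Z₀) : ¬ Function.Injective σ := by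
  have hnot : ¬ Z₀ ≤ LinearMap.ker q := by
    intro hle
    have := Submodule.finrank_mono hle
    omega
  obtain ⟨y, hyZ₀, hyk⟩ := SetLike.not_le_iff_exists.mp hnot
  exact zeroSymbol_not_injective q Sym M σ hfac (hZ₀ y hyZ₀) (by simpa [LinearMap.mem_ker] using hyk)

end ZS

/-! ## §2  Multiplicity one (MULT-1) and the tower apex -/

section MULT

/-- `S = Σ c_k² ≥ Σ c_k = m` for the twist-class sizes of a cell. -/
theorem sum_le_sum_sq {ι : Type*} (s : Finset ι) (c : ι → ℕ) :
    ∑ k ∈ s, c k ≤ ∑ k ∈ s, c k ^ 2 :=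
  Finset.sum_le_sum fun k _ => Nat.le_self_pow two_ne_zero (c k)

/-- (MULT-1).  A cell whose block has no closedness defect and no hit capacity (`cap = 0`: every live partner
non-degenerate) has multiplicity `m = Σ c_k ≤ 1`, because its `28(S − 1)` zero-symbol classes must be `0`. -/
theorem multOne_of_cap_zero {ι : Type*} (s : Finset ι) (c : ι → ℕ)
    (hZS : 28 * (∑ k ∈ s, c k ^ 2 - 1) ≤ 0) : ∑ k ∈ s, c k ≤ 1 := by
  have h := sum_le_sum_sq s c
  omega

/-- (MULT-1), quantitative: `28(S − 1) ≤ cap ⇒ m ≤ 1 + cap / 28`. -/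
theorem mult_le_of_cap {ι : Type*} (s : Finset ι) (c : ι → ℕ) (cap : ℕ)
    (hZS : 28 * (∑ k ∈ s, c k ^ 2 - 1) ≤ cap) : ∑ k ∈ s, c k ≤ 1 + cap / 28 := by
  have h := sum_le_sum_sq s c
  omega

/-- Tower apex `⟨H·1⟩^m` (N side): `cap = 6·m·p_H` where `p_H` is the P-letter mass at scale exactly `H`
(letters strictly below the apex are positive-definite partners and contribute nothing).  `m ≥ 2` forces `p_H ≥ 1`. -/
theorem apexMult_pos (m S p : ℕ) (hm : 2 ≤ m) (hS : m ≤ S) (hZS : 28 * (S - 1) ≤ 6 * m * p) : 1 ≤ p := by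
  rcases Nat.eq_zero_or_pos p with rfl | hp
  · simp at hZS
    omega
  · exact hp

/-- The rank-4 towers of record (apex multiplicity `m = 4`, hence `S ≥ 4`): at least FOUR P letters at the apex scale. -/
theorem apexMult_four (S p : ℕ) (hS : 4 ≤ S) (hZS : 28 * (S - 1) ≤ 6 * 4 * p) : 4 ≤ p := by
  omega

/-- Same with all four apex copies in ONE twist class (`S = 16`): at least `18` P letters at the apex scale. -/
theorem apexMult_four_oneClass (p : ℕ) (hZS : 28 * (16 - 1) ≤ 6 * 4 * p) : 18 ≤ p := by
  omega

end MULT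

/-! ## §3  Rigid directions (DIR) -/

section DIR

variable {K : Type*} [Field K] {V : Type*} [AddCommGroup V] [Module K V]

/-- A linearly independent family lying in the span of `n` vectors has at most `n` members. -/
theorem card_le_of_mem_span {ι : Type*} [Fintype ι] {n : ℕ} (A : Fin n → V) (v : ι → V)
    (hv : ∀ i, v i ∈ Submodule.span K (Set.range A)) (hli : LinearIndependent K v) :
    Fintype.card ι ≤ n := by
  classical
  have h1 : Fintype.card ι = (Set.range v).finrank K :=
    linearIndependent_iff_card_eq_finrank_span.mp hli
  have hle : Submodule.span K (Set.range v) ≤ Submodule.span K (Set.range A) :=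
    Submodule.span_le.mpr (by rintro _ ⟨i, rfl⟩; exact hv i)
  haveI : Module.Finite K (Submodule.span K (Set.range A)) :=
    Module.Finite.span_of_finite K (Set.finite_range A)
  have h2 : (Set.range v).finrank K ≤ (Set.range A).finrank K := Submodule.finrank_mono hle
  have h3 : (Set.range A).finrank K ≤ Fintype.card (Fin n) := finrank_range_le_card A
  simp only [Fintype.card_fin] at h3
  omega

/-- (DIR, one phase).  `d + 2` or more points on a polynomial curve `h ↦ Σ_{j ≤ d} h^j • A_j` are linearly dependent:
the minors vectors `(C_q(h·1 − y))_{q ≤ d}` of the cells of ONE phase `y` at distinct scales `h` lie on such a curve,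
so at most `d + 1 = max I + 1` RIGID cells per phase (`4` at the window `I = {0,1,2,3}`). -/
theorem not_linearIndependent_on_polynomialCurve {ι : Type*} [Fintype ι] {d : ℕ} (A : Fin (d + 1) → V)
    (h : ι → K) (v : ι → V) (hv : ∀ i, v i = ∑ j : Fin (d + 1), h i ^ (j : ℕ) • A j)
    (hcard : d + 1 < Fintype.card ι) : ¬ LinearIndependent K v := by
  intro hli
  have hmem : ∀ i, v i ∈ Submodule.span K (Set.range A) := by
    intro i
    rw [hv i]
    exact Submodule.sum_mem _ fun j _ => Submodule.smul_mem _ _ (Submodule.subset_span ⟨j, rfl⟩)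
  have := card_le_of_mem_span A v hmem hli
  omega

/-- (DIR, PHASE BUDGET).  All tower cells `h·1 − y_φ` with phases in `Φ`: `v(h,φ) = w₀(φ) + h•w₁(φ) + h²•w₂(φ) + h³•u₃`
with the top coefficient `u₃` (principal-minor indicator) PHASE-FREE, so at most `3·#Φ + 1` of them are linearly
independent — at most that many RIGID cells in a C7-passing tower presentation at the window `{0,1,2,3}` (the apex
family `h·1` counts as one more phase `y = 0`).  Numerically the bound is attained for generic `Φ` (`g33/out`). -/
theorem towerRigid_le {ι Φ : Type*} [Fintype ι] [Fintype Φ] (φ : ι → Φ) (h : ι → K)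
    (w₀ w₁ w₂ : Φ → V) (u₃ : V) (v : ι → V)
    (hv : ∀ i, v i = w₀ (φ i) + h i • w₁ (φ i) + h i ^ 2 • w₂ (φ i) + h i ^ 3 • u₃)
    (hli : LinearIndependent K v) : Fintype.card ι ≤ 3 * Fintype.card Φ + 1 := by
  classical
  let S : Finset V := insert u₃ (Finset.univ.biUnion fun p => ({w₀ p, w₁ p, w₂ p} : Finset V))
  have hw : ∀ p, w₀ p ∈ S ∧ w₁ p ∈ S ∧ w₂ p ∈ S := by
    intro p
    refine ⟨?_, ?_, ?_⟩ <;>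
      exact Finset.mem_insert_of_mem (Finset.mem_biUnion.mpr ⟨p, Finset.mem_univ _, by simp⟩)
  have hu : u₃ ∈ S := Finset.mem_insert_self _ _
  have hmem : ∀ i, v i ∈ Submodule.span K (S : Set V) := by
    intro i
    rw [hv i]
    obtain ⟨h0, h1, h2⟩ := hw (φ i)
    refine Submodule.add_mem _ (Submodule.add_mem _ (Submodule.add_mem _ ?_ ?_) ?_) ?_
    · exact Submodule.subset_span (by exact_mod_cast h0)
    · exact Submodule.smul_mem _ _ (Submodule.subset_span (by exact_mod_cast h1))
    · exact Submodule.smul_mem _ _ (Submodule.subset_span (by exact_mod_cast h2))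
    · exact Submodule.smul_mem _ _ (Submodule.subset_span (by exact_mod_cast hu))
  have h1 : Fintype.card ι = (Set.range v).finrank K :=
    linearIndependent_iff_card_eq_finrank_span.mp hli
  have hle : Submodule.span K (Set.range v) ≤ Submodule.span K (S : Set V) :=
    Submodule.span_le.mpr (by rintro _ ⟨i, rfl⟩; exact hmem i)
  haveI : Module.Finite K (Submodule.span K (S : Set V)) :=
    Module.Finite.span_of_finite K S.finite_toSet
  have h2 : (Set.range v).finrank K ≤ ((S : Set V)).finrank K := Submodule.finrank_mono hle
  have h3 : ((S : Set V)).finrank K ≤ S.card := finrank_span_finset_le_card S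
  have h4 : S.card ≤ 3 * Fintype.card Φ + 1 := by
    calc S.card ≤ (Finset.univ.biUnion fun p => ({w₀ p, w₁ p, w₂ p} : Finset V)).card + 1 :=
          Finset.card_insert_le _ _
      _ ≤ (∑ p ∈ (Finset.univ : Finset Φ), ({w₀ p, w₁ p, w₂ p} : Finset V).card) + 1 :=
          Nat.add_le_add_right Finset.card_biUnion_le 1
      _ ≤ (∑ _p ∈ (Finset.univ : Finset Φ), 3) + 1 :=
          Nat.add_le_add_right (Finset.sum_le_sum fun p _ => Finset.card_le_three) 1
      _ = 3 * Fintype.card Φ + 1 := by simp [mul_comm]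
  omega

variable {H W : Type*} [AddCommGroup H] [Module K H] [AddCommGroup W] [Module K W]

/-- The block symbol map of a set of rigid cells: `τ⃗ ↦ Σ_Z v_Z ∪ τ_Z` (`cup` = cup product `H^{q,q} ⊗ H^{0,2} → H^{q,q+2}`,
`v_Z` = the vector `(x_Z^q/q!)_{q ∈ I}`). -/
def blockSymbol {ι : Type*} [Fintype ι] (cup : V →ₗ[K] H →ₗ[K] W) (v : ι → V) : (ι → H) →ₗ[K] W :=
  ∑ i, (cup (v i)) ∘ₗ (LinearMap.proj i)

theorem blockSymbol_apply {ι : Type*} [Fintype ι] (cup : V →ₗ[K] H →ₗ[K] W) (v : ι → V) (τ : ι → H) :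
    blockSymbol cup v τ = ∑ i, cup (v i) (τ i) := by
  simp [blockSymbol, LinearMap.sum_apply]

/-- A linear relation among the directions kills the block symbol on `(λ_Z τ)_Z`. -/
theorem blockSymbol_relation {ι : Type*} [Fintype ι] (cup : V →ₗ[K] H →ₗ[K] W) (v : ι → V) (c : ι → K)
    (hc : ∑ i, c i • v i = 0) (τ : H) : blockSymbol cup v (fun i => c i • τ) = 0 := by
  rw [blockSymbol_apply]
  calc ∑ i, cup (v i) (c i • τ) = ∑ i, cup (c i • v i) τ := by simp [map_smul, LinearMap.smul_apply]
    _ = cup (∑ i, c i • v i) τ := by rw [map_sum, LinearMap.sum_apply]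
    _ = 0 := by rw [hc, map_zero, LinearMap.zero_apply]

/-- (DIR).  Linearly dependent rigid directions ⇒ the block symbol map (hence `σ_I`, by (ZS)) is not injective,
as soon as `H^{0,2} ≠ 0`. -/
theorem blockSymbol_not_injective {ι : Type*} [Fintype ι] (cup : V →ₗ[K] H →ₗ[K] W) (v : ι → V)
    (hdep : ¬ LinearIndependent K v) {τ : H} (hτ : τ ≠ 0) : ¬ Function.Injective (blockSymbol cup v) := by
  obtain ⟨c, hc, i, hi⟩ := Fintype.not_linearIndependent_iff.mp hdep
  intro hinj
  have key : blockSymbol cup v (fun j => c j • τ) = blockSymbol cup v 0 := by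
    rw [blockSymbol_relation cup v c hc τ, map_zero]
  have h0 := congr_fun (hinj key) i
  simp only [Pi.zero_apply, smul_eq_zero] at h0
  rcases h0 with h0 | h0
  · exact hi h0
  · exact hτ h0

/-- The exact relation found by `zerosymbol.py` on synthetic test vector C (one phase at the five scales `20..24`):
the fourth finite difference of a cubic vanishes, coefficients `(1, −4, 6, −4, 1)`. -/
theorem fourthDifference_cubic {R : Type*} [CommRing R] (a b c e x : R) :
    let f : R → R := fun h => a + b * h + c * h ^ 2 + e * h ^ 3
    f x - 4 * f (x + 1) + 6 * f (x + 2) - 4 * f (x + 3) + f (x + 4) = 0 := by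
  intro f
  simp only [f]
  ring

end DIR

/-! ## §4  Census arithmetic (budgets, rigid caps, regression digits) -/

section Census

/-- `h^{q,q+2}(E_i^8) = C(8,q)·C(8,q+2)`; the window `I = {0,1,2,3}` budget of record. -/
theorem windowBudget : 1 * 28 + 8 * 56 + 28 * 70 + 56 * 56 = 5572 := by norm_num

/-- The Buchweitz–Flenner window `{1,2,3,4}` (necessary at the lci door, v21). -/
theorem bfWindowBudget : 8 * 56 + 28 * 70 + 56 * 56 + 70 * 28 = 7504 := by norm_num

/-- All `q`: `Σ_q C(8,q)·C(8,q+2) = C(16,6) = 8008`. -/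
theorem allBudget : ∑ q ∈ Finset.range 7, Nat.choose 8 q * Nat.choose 8 (q + 2) = 8008 := by decide

/-- Rigid caps `⌊budget / 28⌋`: at most this many RIGID cells (each carries `28` closed un-hit scalar classes whose
symbols must be independent). -/
theorem rigidCaps : 5572 / 28 = 199 ∧ 7504 / 28 = 268 ∧ 8008 / 28 = 286 ∧ 3136 / 28 = 112 := by norm_num

/-- toyPresB (sha16 `5768bd6a0f7ae530`): the bottom apex `L_{−4I}^8` has only positive-definite partners (`cap = 0`)
and multiplicity `8`: `28·(8−1) = 196 > 0` — DEAD by (MULT-1), instantly and pattern-free (v32 needed the full count). -/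
theorem toyPresB_bottomApex_dead : ¬ (28 * (8 - 1) ≤ 0) := by norm_num

/-- toyPresB top apex `⟨4·1⟩^40` defers to the count: `cap = 40·32·6 = 7680 ≥ 28·39 = 1092`. -/
theorem toyPresB_topApex_defers : 28 * (40 - 1) ≤ 40 * 32 * 6 := by norm_num

/-- toyPres (sha16 `d66927515841dbdf`) top apex `⟨4·1⟩^33`: `cap = 33·32·6 = 6336 ≥ 28·32 = 896` (toyPres dies by
Chern–Hall, v30, and by the symbol count, v32 — not by the instant screens). -/
theorem toyPres_topApex_defers : 28 * (33 - 1) ≤ 33 * 32 * 6 := by norm_num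

/-- Synthetic test vectors A/B (apex `⟨12·1⟩^4`): strictly above all P letters `cap = 0 < 84` (DEAD); with four
P letters at scale `12`, `cap = 4·4·6 = 96 ≥ 84` (defers). -/
theorem synthetic_apex : ¬ (28 * (4 - 1) ≤ 0) ∧ 28 * (4 - 1) ≤ 4 * 4 * 6 := by norm_num

/-- Synthetic test vector D: the nullity-2 tight pair (gap `4`, relative phase `(0,0,2,2,2,2,0,0)`, oracle `D = 1024`)
gives the doubled letter `cap = 2·1·1024 = 2048 ≥ 28`; at gap `5` (D′) the pair is non-degenerate and the doubled
letter is DEAD. -/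
theorem synthetic_tight : 28 * (2 - 1) ≤ 2 * 1 * 1024 ∧ ¬ (28 * (2 - 1) ≤ 0) := by norm_num

end Census

end Summit.HodgeConjecture.HodgeConjecture.Cruxes.BlochSeedDiscOne.SeedChecker.ZeroSymbol
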